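import Mathlib
import Literature.NumberTheory.DiophantineGeometry.AbcWave0
import Literature.NumberTheory.DiophantineGeometry.AbcValuationProduct
import Literature.NumberTheory.Sieve.DivisorBound
import Summits.ABC.ABC.Theses.DefiniteXi
import HarnessLib

/-!
# Strategist note (crux stmt-ABC-15024 `SteinbergCore`, line `p6_tamagawa_split`):
# child 3 `AbcValuationProduct` is WEAK-RUNG strength

Kernel-checked remark for the STRATEGY CENSUS (§Decomposition / §Strengthen): the third child of the
typed split of `SteinbergCore` — `AbcValuationProduct` (verbatim stmt-ABC-1567,
`∏_{p ∣ abc} v_p(abc) ≤ K_ε rad(abc)^ε`) — follows from ANY polynomial abc inequality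
`c ≤ C · rad(abc)^κ` (one absolute `κ`), by the divisor bound alone:
`∏ v_p(abc) ≤ d(abc) ≤ D_η (abc)^η ≤ D_η c^{3η} ≤ D_η C^{3η} rad^{3κη}`, `η := ε/(3κ)`.

Consequence inside route DefiniteXi: `PolyFreyDegree → AbcValuationProduct` is PROVABLE NOW
(`PolyDegreeToPolyABC` is the proved support item stmt-ABC-2027, theorem
`Summit.ABC.ABC.Theorems.polyDegreeToPolyABC_proof`), so child 3 sits at the strength of the route's
WEAK RUNG (XiBound r2 + polynomial RT control ⟹ PolyFreyDegree), strictly below the abc atom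
`PrimeToSixDegreeBound`; it is not a second abc-strength piece of the split.
-/

set_option linter.dupNamespace false

namespace Summit.ABC.ABC.Cruxes.SteinbergCore.Strategist

open Literature.NumberTheory.DiophantineGeometry

/-- **Polynomial abc ⟹ the valuation-product milestone.** If `c ≤ C · rad(abc)^κ` for all abc
triples (some absolute `κ, C`), then for every `ε > 0` there is `K` with
`∏_{p ∣ abc} v_p(abc) ≤ K · rad(abc)^ε` for all abc triples. Proof: divisor bound. [folklore] -/
theorem abcValuationProduct_of_polyAbc
    (h : ∃ κ C : ℝ, ∀ a b c : ℕ, IsABCTriple a b c → (c : ℝ) ≤ C * ((rad a b c : ℕ) : ℝ) ^ κ) :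
    ∀ ε : ℝ, 0 < ε → ∃ K : ℝ, ∀ a b c : ℕ, IsABCTriple a b c →
      ((∏ p ∈ (a * b * c).primeFactors, (a * b * c).factorization p : ℕ) : ℝ) ≤
        K * ((rad a b c : ℕ) : ℝ) ^ ε := by
  obtain ⟨κ, C, hC⟩ := h
  intro ε hε
  -- normalise: exponent κ' ≥ 1, constant C' ≥ 1
  set κ' : ℝ := max κ 1 with hκ'
  set C' : ℝ := max C 1 with hC'
  have hκ'1 : 1 ≤ κ' := le_max_right _ _
  have hκ'pos : 0 < κ' := lt_of_lt_of_le one_pos hκ'1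
  have hC'1 : 1 ≤ C' := le_max_right _ _
  have hC'pos : 0 < C' := lt_of_lt_of_le one_pos hC'1
  set η : ℝ := ε / (3 * κ') with hη
  have hηpos : 0 < η := by positivity
  obtain ⟨D, hD1, hD⟩ := Literature.NumberTheory.Sieve.exists_card_divisors_le_mul_rpow hηpos
  refine ⟨D * C' ^ (3 * η), ?_⟩
  intro a b c habc
  have hn0 : a * b * c ≠ 0 := habc.mul_ne_zero
  have ha : 0 < a := habc.1
  have hb : 0 < b := habc.2.1
  have hsum : a + b = c := habc.2.2.1
  have hradpos : (0 : ℝ) < ((rad a b c : ℕ) : ℝ) := cast_rad_pos a b c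
  have hrad1 : (1 : ℝ) ≤ ((rad a b c : ℕ) : ℝ) := by
    have h0 : 0 < rad a b c := by exact_mod_cast hradpos
    exact_mod_cast h0
  -- (1) c ≤ C' · rad^κ'
  have hc_le : (c : ℝ) ≤ C' * ((rad a b c : ℕ) : ℝ) ^ κ' := by
    have h1 := hC a b c habc
    have hr0 : (0 : ℝ) ≤ ((rad a b c : ℕ) : ℝ) ^ κ := Real.rpow_nonneg hradpos.le _
    calc (c : ℝ) ≤ C * ((rad a b c : ℕ) : ℝ) ^ κ := h1
      _ ≤ C' * ((rad a b c : ℕ) : ℝ) ^ κ := mul_le_mul_of_nonneg_right (le_max_left _ _) hr0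
      _ ≤ C' * ((rad a b c : ℕ) : ℝ) ^ κ' := by
          refine mul_le_mul_of_nonneg_left ?_ hC'pos.le
          exact Real.rpow_le_rpow_of_exponent_le hrad1 (le_max_left _ _)
  -- (2) n = abc ≤ c³
  have hc0 : (0 : ℝ) ≤ (c : ℝ) := by positivity
  have hn_le : ((a * b * c : ℕ) : ℝ) ≤ (c : ℝ) ^ ((3 : ℝ)) := by
    have hac : a ≤ c := by omega
    have hbc : b ≤ c := by omega
    have : a * b * c ≤ c ^ 3 := by
      calc a * b * c ≤ c * c * c := by gcongr
        _ = c ^ 3 := by ring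
    have h' : ((a * b * c : ℕ) : ℝ) ≤ ((c ^ 3 : ℕ) : ℝ) := by exact_mod_cast this
    rw [Nat.cast_pow] at h'
    rwa [show ((3 : ℝ)) = ((3 : ℕ) : ℝ) by norm_num, Real.rpow_natCast]
  -- (3) ∏ v_p ≤ d(n) ≤ D · n^η
  have hprod_le : ((∏ p ∈ (a * b * c).primeFactors, (a * b * c).factorization p : ℕ) : ℝ) ≤
      D * ((a * b * c : ℕ) : ℝ) ^ η := by
    have h1 : (∏ p ∈ (a * b * c).primeFactors, (a * b * c).factorization p) ≤
        (a * b * c).divisors.card := by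
      have := exponentProduct_le_card_divisors hn0
      rwa [exponentProduct_def] at this
    have h1' : ((∏ p ∈ (a * b * c).primeFactors, (a * b * c).factorization p : ℕ) : ℝ) ≤
        ((a * b * c).divisors.card : ℝ) := by exact_mod_cast h1
    exact h1'.trans (hD (a * b * c) hn0)
  -- (4) n^η ≤ c^{3η} ≤ C'^{3η} rad^ε
  have hpow : ((a * b * c : ℕ) : ℝ) ^ η ≤ C' ^ (3 * η) * ((rad a b c : ℕ) : ℝ) ^ ε := by
    have hn0' : (0 : ℝ) ≤ ((a * b * c : ℕ) : ℝ) := by positivity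
    calc ((a * b * c : ℕ) : ℝ) ^ η ≤ ((c : ℝ) ^ (3 : ℝ)) ^ η := Real.rpow_le_rpow hn0' hn_le hηpos.le
      _ = (c : ℝ) ^ (3 * η) := by rw [← Real.rpow_mul hc0]
      _ ≤ (C' * ((rad a b c : ℕ) : ℝ) ^ κ') ^ (3 * η) :=
          Real.rpow_le_rpow hc0 hc_le (by positivity)
      _ = C' ^ (3 * η) * (((rad a b c : ℕ) : ℝ) ^ κ') ^ (3 * η) :=
          Real.mul_rpow hC'pos.le (Real.rpow_nonneg hradpos.le _)
      _ = C' ^ (3 * η) * ((rad a b c : ℕ) : ℝ) ^ (κ' * (3 * η)) := by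
          rw [← Real.rpow_mul hradpos.le]
      _ = C' ^ (3 * η) * ((rad a b c : ℕ) : ℝ) ^ ε := by
          congr 2
          rw [hη]; field_simp
  -- (5) chain
  have hD0 : (0 : ℝ) ≤ D := le_trans zero_le_one hD1
  calc ((∏ p ∈ (a * b * c).primeFactors, (a * b * c).factorization p : ℕ) : ℝ)
      ≤ D * ((a * b * c : ℕ) : ℝ) ^ η := hprod_le
    _ ≤ D * (C' ^ (3 * η) * ((rad a b c : ℕ) : ℝ) ^ ε) := mul_le_mul_of_nonneg_left hpow hD0
    _ = D * C' ^ (3 * η) * ((rad a b c : ℕ) : ℝ) ^ ε := by ring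

/-- **Inside route DefiniteXi: the weak rung gives child 3.** `PolyFreyDegree` (support item
stmt-ABC-2026, polynomial Szpiro on Frey curves in disguise) together with the PROVED support item
`PolyDegreeToPolyABC` (stmt-ABC-2027) yields `AbcValuationProduct` (child 3 of the split of
`SteinbergCore`, verbatim stmt-ABC-1567). [folklore] -/
theorem abcValuationProduct_of_polyFreyDegree
    (hPD : Summit.ABC.ABC.Theses.DefiniteXi.PolyDegreeToPolyABC)
    (hPF : Summit.ABC.ABC.Theses.DefiniteXi.PolyFreyDegree) :
    ∀ ε : ℝ, 0 < ε → ∃ K : ℝ, ∀ a b c : ℕ, IsABCTriple a b c →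
      ((∏ p ∈ (a * b * c).primeFactors, (a * b * c).factorization p : ℕ) : ℝ) ≤
        K * ((rad a b c : ℕ) : ℝ) ^ ε :=
  abcValuationProduct_of_polyAbc (hPD hPF)

end Summit.ABC.ABC.Cruxes.SteinbergCore.Strategist
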